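import Mathlib

/-!
# Klein-filling certificate for the type-V_B section curve (algebraic core of a Dehn-filling computation)

Solo residency `solo-SmoothPoincare4-informed`, session 12; algebraic core of THEOREM 11.18(a),(b) of the
residency file `paper/poincare-sphere-trick.md` (a prose result under adjudication, not a theorem of this
tree).

Geometric provenance (prose + machine computation, not formalised here).  Let `T ⊂ S³` be the trefoil,
`c` complex conjugation, `W = S³ ×_c S¹`, `P ⊂ S³` the `c`-invariant punctured Klein bottle with `∂P = T`
(THEOREM 11.16), `N_P = P ×_c S¹ ⊂ W`, and `γ_t ⊂ N_P` the graph of the simplest one-sided loop `t` of `P`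
(section class `[zT]`, THEOREM 11.17).  A cubical computation (residency `work/s12/kfill.py`) gives
`π₁(N_P ∖ νγ_t) = ⟨a, b ∣ a⁻¹bab a⁻²b⁻¹ab⁻¹a⁻¹ba²b⁻¹⟩` with meridian `m = ba⁻²b⁻¹a²` and a degree-one
longitude `l₀ = a⁻¹ba`; the degree-one Dehn fillings are along `m^x l₀`, `x ∈ ℤ`, the parity of `x` being
the framing of the 4-dimensional surgery.  A filling with group `ℤ` is a solid Klein bottle in `S⁴` bounded
by the Klein bottle `Kb_{[zT]}`, which is then smoothly unknotted, and every simply connected "Klein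
surgery" on it — in particular one framing of every type-V_B Yoshikawa homotopy 4-sphere — is `S⁴`.

What is proved here (pure group theory, kernel-checked), for the presentation above taken as input:
* `fillGroupZeroEquivInt` : the `x = 0` filling group `⟨a, b ∣ rel, l₀⟩` is isomorphic to `ℤ`
  (generated by `a`);
* `fillGroup_odd_not_comm` : for every odd `x = 2k+1` the filling group `⟨a, b ∣ rel, m^x l₀⟩` maps to
  `S₄` with non-commuting images of `a`, `b` (an explicit `A₄`-representation in which `m` and `l₀` both go
  to the same involution), hence is not commutative and in particular not isomorphic to `ℤ`
  (`isEmpty_fillGroup_odd_mulEquiv_int`).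
(The even `x ≠ 0` fillings are excluded in the residency by torsion `ℤ/(3x²+1)` in a 3-fold cover; that
part is not formalised.)
-/

set_option maxRecDepth 8000

namespace Summit.SmoothPoincare4.SmoothPoincare4.Theorems
namespace KleinFilling

open Multiplicative

/-- Generator `a` (τ-degree `-1`). -/
def ga : FreeGroup Bool := FreeGroup.of false
/-- Generator `b` (τ-degree `+1`). -/
def gb : FreeGroup Bool := FreeGroup.of true

/-- The relator `a⁻¹ b a b a⁻¹ a⁻¹ b⁻¹ a b⁻¹ a⁻¹ b a a b⁻¹` of `π₁(N_P ∖ νγ_t)`. -/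
def rel : FreeGroup Bool :=
  ga⁻¹ * gb * ga * gb * ga⁻¹ * ga⁻¹ * gb⁻¹ * ga * gb⁻¹ * ga⁻¹ * gb * ga * ga * gb⁻¹
/-- The meridian `m = b a⁻¹ a⁻¹ b⁻¹ a a` of `γ_t`. -/
def merid : FreeGroup Bool := gb * ga⁻¹ * ga⁻¹ * gb⁻¹ * ga * ga
/-- A degree-one longitude `l₀ = a⁻¹ b a`. -/
def long0 : FreeGroup Bool := ga⁻¹ * gb * ga
/-- The degree-one slope `m ^ x * l₀`. -/
def slope (x : ℤ) : FreeGroup Bool := merid ^ x * long0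

/-- Relators of the `x`-th degree-one Dehn filling. -/
def fillRels (x : ℤ) : Set (FreeGroup Bool) := {rel, slope x}

/-- The group of the `x`-th degree-one Dehn filling of `N_P ∖ νγ_t`. -/
abbrev FillGroup (x : ℤ) : Type := PresentedGroup (fillRels x)

/-- `rel` is a relator of every filling. -/
theorem rel_mem (x : ℤ) : rel ∈ fillRels x := by simp [fillRels]
/-- `slope x` is a relator of the `x`-th filling. -/
theorem slope_mem (x : ℤ) : slope x ∈ fillRels x := by simp [fillRels]

/-! ## The slope `l₀` (`x = 0`): the filling group is `ℤ` -/

/-- `a ↦ 1`, `b ↦ 0` (written multiplicatively). -/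
def genZ : Bool → Multiplicative ℤ
  | false => ofAdd 1
  | true => 1

/-- `genZ a = 1 ∈ ℤ`. -/
@[simp] theorem genZ_false : genZ false = ofAdd 1 := rfl
/-- `genZ b = 0 ∈ ℤ`. -/
@[simp] theorem genZ_true : genZ true = 1 := rfl

/-- `rel` has `a`-exponent sum `0`. -/
theorem lift_genZ_rel : FreeGroup.lift genZ rel = 1 := by
  simp [rel, ga, gb]

/-- `l₀` has `a`-exponent sum `0`. -/
theorem lift_genZ_slope_zero : FreeGroup.lift genZ (slope 0) = 1 := by
  simp [slope, long0, ga, gb]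

/-- The degree map `FillGroup 0 →* ℤ`. -/
def toZ : FillGroup 0 →* Multiplicative ℤ :=
  PresentedGroup.toGroup (f := genZ) (by
    intro r hr
    simp only [fillRels, Set.mem_insert_iff, Set.mem_singleton_iff] at hr
    rcases hr with rfl | rfl
    · exact lift_genZ_rel
    · exact lift_genZ_slope_zero)

/-- `toZ` on generators. -/
@[simp] theorem toZ_of (u : Bool) : toZ (PresentedGroup.of u) = genZ u := by
  simp [toZ]

/-- In `FillGroup 0` the generator `b` dies: `a⁻¹ b a = 1`. -/
theorem of_true_eq_one : (PresentedGroup.of true : FillGroup 0) = 1 := by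
  have h : (PresentedGroup.mk (fillRels 0) (slope 0)) = 1 :=
    PresentedGroup.one_of_mem (slope_mem 0)
  have h' : (PresentedGroup.of false : FillGroup 0)⁻¹ * PresentedGroup.of true * PresentedGroup.of false
      = 1 := by
    simpa [slope, long0, ga, gb, PresentedGroup.of] using h
  have : (PresentedGroup.of true : FillGroup 0)
      = PresentedGroup.of false *
          ((PresentedGroup.of false)⁻¹ * PresentedGroup.of true * PresentedGroup.of false) *
          (PresentedGroup.of false)⁻¹ := by
    group
  rw [this, h', mul_one, mul_inv_cancel]

/-- `n ↦ a ^ n`. -/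
def fromZ : Multiplicative ℤ →* FillGroup 0 :=
  zpowersHom (FillGroup 0) (PresentedGroup.of false)

/-- `fromZ n = a ^ n`. -/
@[simp] theorem fromZ_apply (n : Multiplicative ℤ) :
    fromZ n = (PresentedGroup.of false : FillGroup 0) ^ n.toAdd := by
  simp [fromZ]

/-- `toZ ∘ fromZ = id`. -/
theorem toZ_comp_fromZ : toZ.comp fromZ = MonoidHom.id _ := by
  ext
  simp

/-- `fromZ ∘ toZ = id`: `a` generates `FillGroup 0`. -/
theorem fromZ_comp_toZ : fromZ.comp toZ = MonoidHom.id _ := by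
  ext u
  cases u with
  | false => simp
  | true => simp [of_true_eq_one]

/-- MAIN STATEMENT (x = 0).  `⟨a, b ∣ rel, a⁻¹ba⟩ ≃* ℤ`, `a ↦ 1`. -/
def fillGroupZeroEquivInt : FillGroup 0 ≃* Multiplicative ℤ :=
  MonoidHom.toMulEquiv toZ fromZ fromZ_comp_toZ toZ_comp_fromZ

/-- The isomorphism sends `a` to `1`. -/
@[simp] theorem fillGroupZeroEquivInt_of_false :
    fillGroupZeroEquivInt (PresentedGroup.of false) = ofAdd 1 := by
  simp [fillGroupZeroEquivInt]

/-- Propositional form of the `x = 0` statement. -/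
theorem nonempty_fillGroup_zero_mulEquiv_int : Nonempty (FillGroup 0 ≃* Multiplicative ℤ) :=
  ⟨fillGroupZeroEquivInt⟩

/-! ## Odd slopes: an `A₄ ⊂ S₄` certificate -/

/-- Image of `a`: the 3-cycle `1 ↦ 2 ↦ 3 ↦ 1` of `Fin 4`. -/
def pA : Equiv.Perm (Fin 4) := Equiv.swap 1 2 * Equiv.swap 2 3
/-- Image of `b`: the double transposition `(0 1)(2 3)`. -/
def pB : Equiv.Perm (Fin 4) := Equiv.swap 0 1 * Equiv.swap 2 3

/-- `a ↦ pA`, `b ↦ pB`. -/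
def genP : Bool → Equiv.Perm (Fin 4)
  | false => pA
  | true => pB

/-- `genP a = pA`. -/
@[simp] theorem genP_false : genP false = pA := rfl
/-- `genP b = pB`. -/
@[simp] theorem genP_true : genP true = pB := rfl

/-- The images of `a` and `b` do not commute. -/
theorem pA_mul_pB_ne : pA * pB ≠ pB * pA := by decide

/-- The relator holds in `S₄` for `(pA, pB)`. -/
theorem lift_genP_rel : FreeGroup.lift genP rel = 1 := by
  simp only [rel, ga, gb, map_mul, map_inv, FreeGroup.lift_apply_of, genP_false, genP_true]
  decide

/-- The meridian goes to an involution `μ` … -/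
theorem lift_genP_merid_sq : (FreeGroup.lift genP merid) ^ 2 = 1 := by
  simp only [merid, ga, gb, map_mul, map_inv, FreeGroup.lift_apply_of, genP_false, genP_true]
  decide

/-- … and the longitude `l₀` goes to the same involution. -/
theorem lift_genP_long0 : FreeGroup.lift genP long0 = FreeGroup.lift genP merid := by
  simp only [merid, long0, ga, gb, map_mul, map_inv, FreeGroup.lift_apply_of, genP_false, genP_true]
  decide

/-- Hence every ODD slope `m^(2k+1) l₀` is killed. -/
theorem lift_genP_slope_odd (k : ℤ) : FreeGroup.lift genP (slope (2 * k + 1)) = 1 := by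
  have hsq := lift_genP_merid_sq
  rw [slope, map_mul, map_zpow, lift_genP_long0, zpow_add, zpow_one, zpow_mul, zpow_ofNat, hsq,
    one_zpow, one_mul, ← pow_two, hsq]

/-- The `A₄`-representation of the odd filling groups. -/
def toPerm (k : ℤ) : FillGroup (2 * k + 1) →* Equiv.Perm (Fin 4) :=
  PresentedGroup.toGroup (f := genP) (by
    intro r hr
    simp only [fillRels, Set.mem_insert_iff, Set.mem_singleton_iff] at hr
    rcases hr with rfl | rfl
    · exact lift_genP_rel
    · exact lift_genP_slope_odd k)

/-- `toPerm` on generators. -/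
@[simp] theorem toPerm_of (k : ℤ) (u : Bool) : toPerm k (PresentedGroup.of u) = genP u := by
  simp [toPerm]

/-- MAIN STATEMENT (odd x).  The odd filling groups are not commutative. -/
theorem fillGroup_odd_not_comm (k : ℤ) :
    (PresentedGroup.of false : FillGroup (2 * k + 1)) * PresentedGroup.of true
      ≠ PresentedGroup.of true * PresentedGroup.of false := by
  intro h
  have := congrArg (toPerm k) h
  simp only [map_mul, toPerm_of, genP_false, genP_true] at this
  exact pA_mul_pB_ne this

/-- In particular no odd filling group is isomorphic to `ℤ`. -/
theorem isEmpty_fillGroup_odd_mulEquiv_int (k : ℤ) :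
    IsEmpty (FillGroup (2 * k + 1) ≃* Multiplicative ℤ) := by
  refine ⟨fun e => fillGroup_odd_not_comm k ?_⟩
  apply e.injective
  rw [map_mul, map_mul, mul_comm]

end KleinFilling
end Summit.SmoothPoincare4.SmoothPoincare4.Theorems
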